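import Mathlib
import Summits.ValiantsHypothesis.ValiantsHypothesis.Theorems.NewtonUnitEquationsDissociatedUniformGreedyCharts

/-!
# Generic stratum of crux `DissociatedUniform` — definitions

Crux stmt-ValiantsHypothesis-5905 (`NewtonUnitEquations.DissociatedUniform`), line `greedy-basis-shadow`, by-product
"generic stratum" (lead c5): on a dissociated frame whose coefficient tensor is in general position (every `k` words of
the box have linearly independent Khatri–Rao columns) the crux's vertex bound holds with an absolute exponent.  This file
holds ALL definitions of the development (the theorem files `…GenericCount/Gaps/Words/Menus/Code/Generic` are
definition-free):
* counting: `Tset d k` = tuples `g : Fin d → ℕ` with `∏ (1 + g s) ≤ k`;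
* sorted gaps of a finite set `R ⊆ ℕ`: `enumN`, `preN`, `gapN`, and the unordered gap `ugap`;
* words (abstract setting: coordinates `ι`, letters `L`, alphabets `A : ι → Finset L`, letter height `φ : L → ℝ`):
  additive word height `Hw`, top letter `top`, second letter `sec`, best demotion weight `bestw`, coordinate rank `crank`
  (among the BIG coordinates = those with a letter other than the top one), demoted set `dem`, letter menu `U`, letter
  rank `lrank`, gap `G`, menu word `W`, admissible choices `menu`, rank set `Rset`, `lrankAt`, the code `gcode`/`lcode`
  and the code space `codeSpace`;
* frames: the letter height `letterHeight ε λ l = ε l₀ + λ l₁` of the chart `ε X + λ Y`;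
* and the one lemma that links general position to counting: a lex-greedy word (`QuasiPoly.gE`) of a configuration in
  which every `k` points of `E` have independent vectors has fewer than `k` words strictly above it
  (`card_filter_lt_of_mem_gE`, registered sub-goal).
Junk values (documented): `top` of an empty alphabet is `default`; `sec` of a one-letter alphabet is its top letter;
`enumN R n = 0` for `n ≥ |R|`.
-/

open scoped BigOperators

-- Sub = Summit single-conjunct layout: the duplicated namespace component is mandated by the tree.
set_option linter.dupNamespace false

namespace Summit.ValiantsHypothesis.ValiantsHypothesis.Theorems.NewtonUnitEquationsDissociatedUniform

namespace Generic

noncomputable section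

/-! ## Counting -/

/-- The tuples `g : Fin d → ℕ` with `∏ s, (1 + g s) ≤ k` (as a finset: every coordinate is `< k`). -/
def Tset (d k : ℕ) : Finset (Fin d → ℕ) :=
  (Fintype.piFinset fun _ : Fin d => Finset.range k).filter fun g => ∏ s, (1 + g s) ≤ k

attribute [irreducible] Tset

/-! ## Sorted gaps of a finite set of naturals -/

/-- Total, `ℕ`-indexed sorted enumeration of a finite set of naturals (`0` beyond the cardinality). -/
def enumN (R : Finset ℕ) (n : ℕ) : ℕ :=
  if h : n < R.card then R.orderEmbOfFin rfl ⟨n, h⟩ else 0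

/-- One more than the previous element of the enumeration (`0` at the start). -/
def preN (R : Finset ℕ) (n : ℕ) : ℕ :=
  if n = 0 then 0 else enumN R (n - 1) + 1

/-- The `n`-th sorted gap of `R`. -/
def gapN (R : Finset ℕ) (n : ℕ) : ℕ := enumN R n - preN R n

/-- The unordered gap of `r` in `R`: the number of `n ≤ r` lying above every element of `R` below `r`. -/
def ugap (R : Finset ℕ) (r : ℕ) : ℕ :=
  ((Finset.range (r + 1)).filter fun n => ∀ r' ∈ R, r' < r → r' < n).card

/-! ## Words -/

variable {ι L : Type}

/-- Additive word height. -/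
def Hw [Fintype ι] (φ : L → ℝ) (a : ι → L) : ℝ := ∑ j, φ (a j)

/-- The top letter of coordinate `j` (a `φ`-maximal letter of `A j`; junk `default` if `A j = ∅`). -/
def top [Inhabited L] (A : ι → Finset L) (φ : L → ℝ) (j : ι) : L :=
  if h : (A j).Nonempty then Classical.choose (Finset.exists_max_image (A j) φ h) else default

/-- The second letter of coordinate `j` (a `φ`-maximal letter of `A j` other than the top one; the top letter itself
if `A j` has at most one letter). -/
def sec [Inhabited L] [DecidableEq L] (A : ι → Finset L) (φ : L → ℝ) (j : ι) : L :=
  if h : ((A j).erase (top A φ j)).Nonempty then Classical.choose (Finset.exists_max_image _ φ h) else top A φ j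

/-- The best (smallest) demotion weight of coordinate `j`. -/
def bestw [Inhabited L] [DecidableEq L] (A : ι → Finset L) (φ : L → ℝ) (j : ι) : ℝ := φ (top A φ j) - φ (sec A φ j)

/-- The rank of a coordinate among the big coordinates (those with a letter other than the top one), by best demotion
weight. -/
def crank [Fintype ι] [Inhabited L] [DecidableEq L] (A : ι → Finset L) (φ : L → ℝ) (j : ι) : ℕ :=
  (Finset.univ.filter fun c => ((A c).erase (top A φ c)).Nonempty ∧ bestw A φ c < bestw A φ j).card

/-- The demoted coordinates of a word. -/
def dem [Fintype ι] [Inhabited L] [DecidableEq L] (A : ι → Finset L) (φ : L → ℝ) (a : ι → L) : Finset ι :=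
  Finset.univ.filter fun j => a j ≠ top A φ j

/-- The menu of coordinate `j` at the word `a`: letters of `A j` at least as high as `a j`. -/
def U (A : ι → Finset L) (φ : L → ℝ) (a : ι → L) (j : ι) : Finset L := (A j).filter fun l => φ (a j) ≤ φ l

/-- The letter rank of `a j` in `A j`: letters strictly higher. -/
def lrank (A : ι → Finset L) (φ : L → ℝ) (a : ι → L) (j : ι) : ℕ := ((A j).filter fun l => φ (a j) < φ l).card

/-- The gap of a demoted coordinate `j` of `a`: big coordinates whose best demotion weight lies strictly between the best
demotion weights of the demoted coordinates below `j` and that of `j`. -/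
def G [Fintype ι] [Inhabited L] [DecidableEq L] (A : ι → Finset L) (φ : L → ℝ) (a : ι → L) (j : ι) : Finset ι :=
  Finset.univ.filter fun c => ((A c).erase (top A φ c)).Nonempty ∧ bestw A φ c < bestw A φ j ∧
    ∀ j' ∈ dem A φ a, bestw A φ j' < bestw A φ j → bestw A φ j' < bestw A φ c

/-- The menu word of a choice `g`: undo the demotion at the coordinates where `g` chooses, and demote the chosen gap
coordinates to their second letter. -/
def W [Fintype ι] [DecidableEq ι] [Inhabited L] [DecidableEq L] (A : ι → Finset L) (φ : L → ℝ) (a : ι → L)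
    (g : ι → Option ι) (i : ι) : L :=
  if g i ≠ none then top A φ i else if ∃ j, g j = some i then sec A φ i else a i

/-- The admissible choices: at a demoted coordinate, nothing or a coordinate of its gap; elsewhere nothing. -/
def menu [Fintype ι] [DecidableEq ι] [Inhabited L] [DecidableEq L] (A : ι → Finset L) (φ : L → ℝ) (a : ι → L) :
    Finset (ι → Option ι) :=
  Fintype.piFinset fun j => if j ∈ dem A φ a then Finset.insertNone (G A φ a j) else {none}

/-- The rank set of a word: the coordinate ranks of its demoted coordinates. -/
def Rset [Fintype ι] [Inhabited L] [DecidableEq L] (A : ι → Finset L) (φ : L → ℝ) (a : ι → L) : Finset ℕ :=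
  (dem A φ a).image (crank A φ)

/-- The letter rank of `a` at the demoted coordinate of rank `r` (`0` if there is none). -/
def lrankAt [Fintype ι] [Inhabited L] [DecidableEq L] (A : ι → Finset L) (φ : L → ℝ) (a : ι → L) (r : ℕ) : ℕ :=
  ∑ j ∈ (dem A φ a).filter (fun j => crank A φ j = r), lrank A φ a j

/-- First component of the code: the padded sorted gaps of the rank set. -/
def gcode [Fintype ι] [Inhabited L] [DecidableEq L] (N : ℕ) (A : ι → Finset L) (φ : L → ℝ) (a : ι → L) :
    Fin N → ℕ := fun s => gapN (Rset A φ a) s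

/-- Second component of the code: the letter ranks in rank order, padded by zeros. -/
def lcode [Fintype ι] [Inhabited L] [DecidableEq L] (N : ℕ) (A : ι → Finset L) (φ : L → ℝ) (a : ι → L) :
    Fin N → ℕ := fun s =>
  if (s : ℕ) < (Rset A φ a).card then lrankAt A φ a (enumN (Rset A φ a) s) else 0

/-- The code space: `d ≤ log₂ k` and two tuples of `Tset N k`. -/
def codeSpace (k N : ℕ) : Finset (ℕ × (Fin N → ℕ) × (Fin N → ℕ)) :=
  Finset.range (Nat.log 2 k + 1) ×ˢ (Tset N k ×ˢ Tset N k)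

/-! ## Frames -/

/-- The letter height of the chart `ε X + λ Y`. -/
def letterHeight (ε lam : ℝ) (l : Fin 2 →₀ ℕ) : ℝ := ε * ((l 0 : ℕ) : ℝ) + lam * ((l 1 : ℕ) : ℝ)

/-! ## General position ⇒ greedy words are top-`k` words -/

/-- Under general position (every `k` words of `E` have independent columns), a lex-greedy word has fewer than `k` words
strictly above it. -/
theorem card_filter_lt_of_mem_gE {α : Type} [DecidableEq α] {k : ℕ} (E : Finset α) (x : α → Fin k → ℂ) (h : α → ℝ)
    (hgen : ∀ S : Finset α, S ⊆ E → S.card = k → LinearIndependent ℂ (fun s : S => x s)) {a : α}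
    (ha : a ∈ QuasiPoly.gE E x h) : (E.filter fun b => h a < h b).card < k := by
  by_contra hge
  obtain ⟨S, hS, hScard⟩ := Finset.exists_subset_card_eq (not_lt.mp hge)
  have hSE : S ⊆ E := hS.trans (Finset.filter_subset _ _)
  have hli := hgen S hSE hScard
  have hspan : Submodule.span ℂ (Set.range fun s : S => x s) = ⊤ :=
    hli.span_eq_top_of_card_eq_finrank' (by rw [Fintype.card_coe, hScard, Module.finrank_fin_fun])
  apply ha.2
  have hsub : Set.range (fun s : S => x s) ⊆ x '' {e' : α | e' ∈ E ∧ h a < h e'} := by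
    rintro v ⟨s, rfl⟩
    have hs := Finset.mem_filter.mp (hS s.2)
    exact ⟨s, ⟨hs.1, hs.2⟩, rfl⟩
  have : x a ∈ Submodule.span ℂ (Set.range fun s : S => x s) := by rw [hspan]; exact Submodule.mem_top
  exact Submodule.span_mono hsub this

end

end Generic

end Summit.ValiantsHypothesis.ValiantsHypothesis.Theorems.NewtonUnitEquationsDissociatedUniform
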